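import Summits.ValiantsHypothesis.ValiantsHypothesis.Theorems.BarrierLeverChowBenchmarkPairsDirichletGroup

/-!
# Route BarrierLever — item 22038 `ChowBenchmarkPairs`, line `moore-peel`: rule (R3) of THEOREM W —
# a window whose ROWS cross a power of two lowers the Dirichlet parameter by one

Helper file (`--supports stmt-ValiantsHypothesis-22038`; cell valiant-natproofs, rung V4, 𝒟-side benchmark of
record, line `moore_peel`, card v12d structural target #1; seat val-np-p4 gen 27, memo
`HOME/val-np-p4/g27/MEMO-valnp4-g27.md` §1 (R3)).  Closes NO item.  Auxiliary definitions: the index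
equivalences `liftRows`, `liftCols`, the code map `hcode`, and the three matrices `liftM`, `liftL`, `liftP` of the proof.

**(R3)** `det_dirichletWindow_lift`: if `n + c = 2^k` and `i ≤ n` then
`det d(2^k + i, c)(x) = ± x^c · det d(i, c)(x - 1)`.
PROOF (memo §1).  Reindex rows as `[c, 2^k) | [0, c) | 2^k + [0, i)` and columns as codes `[c, 2^k) | 2^k + [0, c+i)`
(`liftM`); multiply on the left by `liftL = F^{-x}` on the low rows (block unipotent, det 1) and on the right by
`liftP = F^{-1}` on the high columns (unipotent, det 1).  By the group law on codes (`sum_dz_mul_dz`: `F^{-x}F^x = 1`,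
`F^{-x}·(x F^{x+1}) = x F^1`, `F^1 F^{-1} = 1`, `F^x F^{-1} = F^{x-1}`) the product is block upper triangular
`[[1, *], [0, D]]` with `D = [[x·1_c, 0], [*, d(i,c)(x-1)]]`, whence the determinant.

WHAT THIS IS NOT: nothing on the segment-mean stub, on crux stmt-ValiantsHypothesis-14610 or on `VP` versus `VNP`.
-/

set_option linter.dupNamespace false

namespace Summit.ValiantsHypothesis.ValiantsHypothesis.Theorems.BarrierLever.MoorePeel

open Finset Matrix

variable {R : Type*} [CommRing R]

section Lift

variable (x : R) (c n i : ℕ)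

/-- Row reindexing `Fin n ⊕ (Fin c ⊕ Fin i) ≃ Fin (n + c + i)`: `inl t ↦ c + t`, `inr (inl j) ↦ j`,
`inr (inr j₁) ↦ n + c + j₁`. -/
def liftRows : Fin n ⊕ (Fin c ⊕ Fin i) ≃ Fin (n + c + i) :=
  (Equiv.sumAssoc (Fin n) (Fin c) (Fin i)).symm.trans
    ((Equiv.sumCongr ((Equiv.sumComm (Fin n) (Fin c)).trans
      (finSumFinEquiv.trans (finCongr (Nat.add_comm c n)))) (Equiv.refl (Fin i))).trans finSumFinEquiv)

/-- Column reindexing `Fin n ⊕ (Fin c ⊕ Fin i) ≃ Fin (n + c + i)`: `inl t ↦ t`, `inr (inl j) ↦ n + j`,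
`inr (inr j₁) ↦ n + c + j₁`. -/
def liftCols : Fin n ⊕ (Fin c ⊕ Fin i) ≃ Fin (n + c + i) :=
  (Equiv.sumCongr (Equiv.refl (Fin n)) finSumFinEquiv).trans
    (finSumFinEquiv.trans (finCongr (Nat.add_assoc n c i).symm))

/-- The high code of a column label: `inl j ↦ j`, `inr j₁ ↦ c + j₁`. -/
def hcode : Fin c ⊕ Fin i → ℕ := Sum.elim (fun j => (j : ℕ)) (fun j₁ => c + (j₁ : ℕ))

/-- Value of `liftRows` on `inl`. -/
@[simp] theorem liftRows_inl (t : Fin n) : ((liftRows c n i (Sum.inl t) : Fin (n + c + i)) : ℕ) = c + t := by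
  simp [liftRows, Nat.add_comm]

/-- Value of `liftRows` on `inr inl`. -/
@[simp] theorem liftRows_inr_inl (j : Fin c) :
    ((liftRows c n i (Sum.inr (Sum.inl j)) : Fin (n + c + i)) : ℕ) = j := by
  simp [liftRows]

/-- Value of `liftRows` on `inr inr`. -/
@[simp] theorem liftRows_inr_inr (j : Fin i) :
    ((liftRows c n i (Sum.inr (Sum.inr j)) : Fin (n + c + i)) : ℕ) = n + c + j := by
  simp [liftRows]

/-- Value of `liftCols` on `inl`. -/
@[simp] theorem liftCols_inl (t : Fin n) : ((liftCols c n i (Sum.inl t) : Fin (n + c + i)) : ℕ) = t := by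
  simp [liftCols]

/-- Value of `liftCols` on `inr`. -/
@[simp] theorem liftCols_inr (w : Fin c ⊕ Fin i) :
    ((liftCols c n i (Sum.inr w) : Fin (n + c + i)) : ℕ) = n + hcode c i w := by
  cases w <;> simp [liftCols, hcode]

/-- `hcode` is the value of `finSumFinEquiv`. -/
theorem hcode_eq (w : Fin c ⊕ Fin i) : hcode c i w = ((finSumFinEquiv w : Fin (c + i)) : ℕ) := by
  cases w <;> simp [hcode]

/-- `hcode w < c + i`. -/
theorem hcode_lt (w : Fin c ⊕ Fin i) : hcode c i w < c + i := by
  rw [hcode_eq]; exact Fin.isLt _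

/-- Summing a function of the high code over the column labels. -/
theorem sum_hcode (g : ℕ → R) : ∑ w : Fin c ⊕ Fin i, g (hcode c i w) = ∑ v : Fin (c + i), g (v : ℕ) := by
  rw [Fintype.sum_sum_type, Fin.sum_univ_add]
  simp [hcode]

/-- Splitting a sum over the codes `< c + n` into `[0,c)` and `[c, c+n)`. -/
theorem sum_split (g : ℕ → R) :
    ∑ j : Fin c, g (j : ℕ) + ∑ t : Fin n, g (c + (t : ℕ)) = ∑ u : Fin (c + n), g (u : ℕ) := by
  rw [Fin.sum_univ_add]
  simp

/-! ## The three matrices -/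

section Matrices

variable (x : R) {k c n i : ℕ} (hP : n + c = 2 ^ k) (hi : i ≤ n)

/-- The window `d(n + c + i, c)` reindexed: rows `[c, 2^k) | [0, c) | 2^k + [0, i)`, columns by code
`[c, 2^k) | 2^k + hcode`. -/
def liftM (c n i : ℕ) : Matrix (Fin n ⊕ (Fin c ⊕ Fin i)) (Fin n ⊕ (Fin c ⊕ Fin i)) R :=
  (dirichletWindow x (n + c + i) c).submatrix (liftRows c n i) (liftCols c n i)

/-- The left multiplier: `F^{-x}` on the low rows (codes `< 2^k`), identity on the high rows. -/
def liftL (c n i : ℕ) : Matrix (Fin n ⊕ (Fin c ⊕ Fin i)) (Fin n ⊕ (Fin c ⊕ Fin i)) R :=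
  Matrix.fromBlocks (dzDiag (-x) n c) 0
    (Matrix.of (Sum.elim (fun (j : Fin c) (t : Fin n) => dz (-x) (j : ℕ) (c + (t : ℕ))) (fun _ _ => 0)))
    (Matrix.fromBlocks (dzDiag (-x) c 0) 0 0 1)

variable (R) in
/-- The right multiplier: identity on the low columns, `F^{-1}` on the high columns. -/
def liftP (c n i : ℕ) : Matrix (Fin n ⊕ (Fin c ⊕ Fin i)) (Fin n ⊕ (Fin c ⊕ Fin i)) R :=
  Matrix.fromBlocks 1 0 0 ((dzDiag (-1 : R) (c + i) 0).submatrix finSumFinEquiv finSumFinEquiv)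

/-- `det liftL = 1`. -/
theorem det_liftL : (liftL x c n i).det = 1 := by
  rw [liftL, Matrix.det_fromBlocks_zero₁₂, det_dzDiag, Matrix.det_fromBlocks_zero₁₂, det_dzDiag,
    Matrix.det_one, one_mul, one_mul]

variable (R) in
/-- `det liftP = 1`. -/
theorem det_liftP : (liftP R c n i).det = 1 := by
  rw [liftP, Matrix.det_fromBlocks_zero₁₂, Matrix.det_one, Matrix.det_submatrix_equiv_self, det_dzDiag,
    one_mul]

/-- Entries of `liftM`: low row `c + t`, low column `c + t'`. -/
theorem liftM_inl_inl (t t' : Fin n) :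
    liftM x c n i (Sum.inl t) (Sum.inl t') = dz x (c + (t : ℕ)) (c + (t' : ℕ)) := by
  rw [liftM, Matrix.submatrix_apply, dirichletWindow_eq_dz, liftRows_inl, liftCols_inl]

include hP hi in
/-- Entries of `liftM`: low row `c + t`, high column `2^k + hcode w`. -/
theorem liftM_inl_inr (t : Fin n) (w : Fin c ⊕ Fin i) :
    liftM x c n i (Sum.inl t) (Sum.inr w) = x * dz (x + 1) (c + (t : ℕ)) (hcode c i w) := by
  rw [liftM, Matrix.submatrix_apply, dirichletWindow_eq_dz, liftRows_inl, liftCols_inr,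
    show c + (n + hcode c i w) = 2 ^ k + hcode c i w by omega]
  have := hcode_lt c i w
  exact dz_two_pow_add_right x (by have := t.isLt; omega) (by omega)

/-- Entries of `liftM`: row `j < c`, low column `c + t'`. -/
theorem liftM_inr_inl_inl (j : Fin c) (t' : Fin n) :
    liftM x c n i (Sum.inr (Sum.inl j)) (Sum.inl t') = dz x (j : ℕ) (c + (t' : ℕ)) := by
  rw [liftM, Matrix.submatrix_apply, dirichletWindow_eq_dz, liftRows_inr_inl, liftCols_inl]

include hP hi in
/-- Entries of `liftM`: row `j < c`, high column. -/
theorem liftM_inr_inl_inr (j : Fin c) (w : Fin c ⊕ Fin i) :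
    liftM x c n i (Sum.inr (Sum.inl j)) (Sum.inr w) = x * dz (x + 1) (j : ℕ) (hcode c i w) := by
  rw [liftM, Matrix.submatrix_apply, dirichletWindow_eq_dz, liftRows_inr_inl, liftCols_inr,
    show c + (n + hcode c i w) = 2 ^ k + hcode c i w by omega]
  have := hcode_lt c i w
  exact dz_two_pow_add_right x (by have := j.isLt; omega) (by omega)

include hP hi in
/-- Entries of `liftM`: high row, low column — zero. -/
theorem liftM_inr_inr_inl (j : Fin i) (t' : Fin n) :
    liftM x c n i (Sum.inr (Sum.inr j)) (Sum.inl t') = 0 := by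
  rw [liftM, Matrix.submatrix_apply, dirichletWindow_eq_dz, liftRows_inr_inr, liftCols_inl,
    show n + c + (j : ℕ) = 2 ^ k + (j : ℕ) by omega]
  exact dz_two_pow_add_left x (by have := j.isLt; omega) (by have := t'.isLt; omega)

include hP hi in
/-- Entries of `liftM`: high row, high column. -/
theorem liftM_inr_inr_inr (j : Fin i) (w : Fin c ⊕ Fin i) :
    liftM x c n i (Sum.inr (Sum.inr j)) (Sum.inr w) = dz x (j : ℕ) (hcode c i w) := by
  rw [liftM, Matrix.submatrix_apply, dirichletWindow_eq_dz, liftRows_inr_inr, liftCols_inr,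
    show n + c + (j : ℕ) = 2 ^ k + (j : ℕ) by omega, show c + (n + hcode c i w) = 2 ^ k + hcode c i w by omega]
  have := hcode_lt c i w
  exact dz_two_pow_add_add x (by have := j.isLt; omega) (by omega)

/-! ## The product `liftL · liftM · liftP` -/

/-- The product matrix. -/
def liftZ (c n i : ℕ) : Matrix (Fin n ⊕ (Fin c ⊕ Fin i)) (Fin n ⊕ (Fin c ⊕ Fin i)) R :=
  liftL x c n i * liftM x c n i * liftP R c n i

/-- Entries of `liftL · liftM` in a low row `c + t`: only the diagonal low block of `liftL` contributes. -/
theorem liftLM_inl (t : Fin n) (q : Fin n ⊕ (Fin c ⊕ Fin i)) :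
    (liftL x c n i * liftM x c n i) (Sum.inl t) q =
      ∑ t'' : Fin n, dz (-x) (c + (t : ℕ)) (c + (t'' : ℕ)) * liftM x c n i (Sum.inl t'') q := by
  rw [Matrix.mul_apply, Fintype.sum_sum_type]
  simp [liftL, dzDiag_apply]

/-- Entries of `liftL · liftM` in a row `j < c`. -/
theorem liftLM_inr_inl (j : Fin c) (q : Fin n ⊕ (Fin c ⊕ Fin i)) :
    (liftL x c n i * liftM x c n i) (Sum.inr (Sum.inl j)) q =
      ∑ t'' : Fin n, dz (-x) (j : ℕ) (c + (t'' : ℕ)) * liftM x c n i (Sum.inl t'') q +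
      ∑ j'' : Fin c, dz (-x) (j : ℕ) (j'' : ℕ) * liftM x c n i (Sum.inr (Sum.inl j'')) q := by
  rw [Matrix.mul_apply, Fintype.sum_sum_type, Fintype.sum_sum_type]
  simp [liftL, dzDiag_apply]

/-- Entries of `liftL · liftM` in a high row: unchanged. -/
theorem liftLM_inr_inr (j : Fin i) (q : Fin n ⊕ (Fin c ⊕ Fin i)) :
    (liftL x c n i * liftM x c n i) (Sum.inr (Sum.inr j)) q = liftM x c n i (Sum.inr (Sum.inr j)) q := by
  rw [Matrix.mul_apply, Fintype.sum_sum_type, Fintype.sum_sum_type]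
  simp [liftL, Matrix.one_apply]

/-- Entries of `Z` in a low column: `liftP` is the identity there. -/
theorem liftZ_inl (r : Fin n ⊕ (Fin c ⊕ Fin i)) (t' : Fin n) :
    liftZ x c n i r (Sum.inl t') = (liftL x c n i * liftM x c n i) r (Sum.inl t') := by
  rw [liftZ, Matrix.mul_apply, Fintype.sum_sum_type]
  simp [liftP, Matrix.one_apply]

/-- Entries of `Z` in a high column. -/
theorem liftZ_inr (r : Fin n ⊕ (Fin c ⊕ Fin i)) (w' : Fin c ⊕ Fin i) :
    liftZ x c n i r (Sum.inr w') = ∑ w : Fin c ⊕ Fin i,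
      (liftL x c n i * liftM x c n i) r (Sum.inr w) * dz (-1 : R) (hcode c i w) (hcode c i w') := by
  rw [liftZ, Matrix.mul_apply, Fintype.sum_sum_type]
  simp [liftP, dzDiag_apply, hcode_eq]

include hP in
/-- `Z` on (low row, low column): the identity (`F^{-x} F^x = 1`). -/
theorem liftZ_inl_inl (t t' : Fin n) : liftZ x c n i (Sum.inl t) (Sum.inl t') = if t = t' then 1 else 0 := by
  rw [liftZ_inl, liftLM_inl]
  simp_rw [liftM_inl_inl x]
  rw [show ∑ t'' : Fin n, dz (-x) (c + (t : ℕ)) (c + (t'' : ℕ)) * dz x (c + (t'' : ℕ)) (c + (t' : ℕ))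
      = dz (-x + x) (c + (t : ℕ)) (c + (t' : ℕ)) from
      sum_dz_mul_dz (-x) x (by omega) (by have := t'.isLt; omega), neg_add_cancel, dz_zero]
  simp [Fin.ext_iff]

include hP in
/-- `Z` on (row `j < c`, low column): zero. -/
theorem liftZ_inr_inl_inl (j : Fin c) (t' : Fin n) : liftZ x c n i (Sum.inr (Sum.inl j)) (Sum.inl t') = 0 := by
  rw [liftZ_inl, liftLM_inr_inl]
  simp_rw [liftM_inl_inl x, liftM_inr_inl_inl x]
  rw [add_comm, sum_split c n (fun u => dz (-x) (j : ℕ) u * dz x u (c + (t' : ℕ)))]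
  have e := sum_dz_mul_dz (-x) x (a := (j : ℕ)) (b := c + (t' : ℕ)) (off := 0) (N := c + n)
    (Nat.zero_le _) (by have := t'.isLt; omega)
  simp_rw [zero_add] at e
  rw [e, neg_add_cancel, dz_zero, if_neg]
  have := j.isLt
  omega

include hP hi in
/-- `Z` on (high row, low column): zero. -/
theorem liftZ_inr_inr_inl (j : Fin i) (t' : Fin n) : liftZ x c n i (Sum.inr (Sum.inr j)) (Sum.inl t') = 0 := by
  rw [liftZ_inl, liftLM_inr_inr, liftM_inr_inr_inl x hP hi]

include hP hi in
/-- `liftL · liftM` on (row `j < c`, high column `w`): `x · F^1[j, hcode w]` (`F^{-x} · x F^{x+1} = x F^1`). -/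
theorem liftLM_inr_inl_inr (j : Fin c) (w : Fin c ⊕ Fin i) :
    (liftL x c n i * liftM x c n i) (Sum.inr (Sum.inl j)) (Sum.inr w) = x * dz 1 (j : ℕ) (hcode c i w) := by
  rw [liftLM_inr_inl]
  simp_rw [liftM_inl_inr x hP hi, liftM_inr_inl_inr x hP hi]
  have hw := hcode_lt c i w
  have e := sum_dz_mul_dz (-x) (x + 1) (a := (j : ℕ)) (b := hcode c i w) (off := 0) (N := c + n)
    (Nat.zero_le _) (by omega)
  simp_rw [zero_add] at e
  rw [show (-x) + (x + 1) = 1 by ring] at e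
  rw [← e, ← sum_split c n (fun u => dz (-x) (j : ℕ) u * dz (x + 1) u (hcode c i w)), add_comm,
    mul_add, Finset.mul_sum, Finset.mul_sum]
  congr 1 <;> refine Finset.sum_congr rfl fun _ _ => ?_ <;> ring

include hP hi in
/-- `Z` on (row `j < c`, high column `w'`): `x · [j = hcode w']`. -/
theorem liftZ_inr_inl_inr (j : Fin c) (w' : Fin c ⊕ Fin i) :
    liftZ x c n i (Sum.inr (Sum.inl j)) (Sum.inr w') = if (j : ℕ) = hcode c i w' then x else 0 := by
  rw [liftZ_inr]
  simp_rw [liftLM_inr_inl_inr x hP hi, mul_assoc]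
  rw [← Finset.mul_sum, sum_hcode c i (fun v => dz 1 (j : ℕ) v * dz (-1 : R) v (hcode c i w'))]
  have e := sum_dz_mul_dz (1 : R) (-1) (a := (j : ℕ)) (b := hcode c i w') (off := 0) (N := c + i)
    (Nat.zero_le _) (by have := hcode_lt c i w'; omega)
  simp_rw [zero_add] at e
  rw [e, add_neg_cancel, dz_zero]
  split_ifs <;> simp

include hP hi in
/-- `Z` on (high row `j`, high column `w'`): `F^{x-1}[j, hcode w']` (`F^x F^{-1} = F^{x-1}`). -/
theorem liftZ_inr_inr_inr (j : Fin i) (w' : Fin c ⊕ Fin i) :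
    liftZ x c n i (Sum.inr (Sum.inr j)) (Sum.inr w') = dz (x - 1) (j : ℕ) (hcode c i w') := by
  rw [liftZ_inr]
  simp_rw [liftLM_inr_inr, liftM_inr_inr_inr x hP hi]
  rw [sum_hcode c i (fun v => dz x (j : ℕ) v * dz (-1 : R) v (hcode c i w'))]
  have e := sum_dz_mul_dz x (-1 : R) (a := (j : ℕ)) (b := hcode c i w') (off := 0) (N := c + i)
    (Nat.zero_le _) (by have := hcode_lt c i w'; omega)
  simp_rw [zero_add] at e
  rw [e, sub_eq_add_neg]

/-! ## Assembly -/

include hP hi in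
/-- `Z` is block upper triangular with identity top-left block, and its bottom-right block is block lower
triangular with blocks `x · 1` and `d(i,c)(x-1)`: `det Z = x^c · det d(i,c)(x-1)`. -/
theorem det_liftZ : (liftZ x c n i).det = x ^ c * (dirichletWindow (x - 1) i c).det := by
  rw [← Matrix.fromBlocks_toBlocks (liftZ x c n i)]
  have h11 : (liftZ x c n i).toBlocks₁₁ = 1 := by
    ext t t'
    rw [Matrix.toBlocks₁₁, Matrix.of_apply, liftZ_inl_inl x hP, Matrix.one_apply]
  have h21 : (liftZ x c n i).toBlocks₂₁ = 0 := by
    ext w t'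
    rw [Matrix.toBlocks₂₁, Matrix.of_apply, Matrix.zero_apply]
    cases w with
    | inl j => exact liftZ_inr_inl_inl x hP j t'
    | inr j => exact liftZ_inr_inr_inl x hP hi j t'
  rw [h11, h21, Matrix.det_fromBlocks_zero₂₁, Matrix.det_one, one_mul]
  set D := (liftZ x c n i).toBlocks₂₂ with hD
  rw [← Matrix.fromBlocks_toBlocks D]
  have d11 : D.toBlocks₁₁ = x • (1 : Matrix (Fin c) (Fin c) R) := by
    ext j j'
    rw [hD, Matrix.toBlocks₁₁, Matrix.of_apply, Matrix.toBlocks₂₂, Matrix.of_apply,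
      liftZ_inr_inl_inr x hP hi, Matrix.smul_apply, Matrix.one_apply, smul_eq_mul, mul_ite, mul_one,
      mul_zero]
    simp [hcode, Fin.ext_iff]
  have d12 : D.toBlocks₁₂ = 0 := by
    ext j j'
    rw [hD, Matrix.toBlocks₁₂, Matrix.of_apply, Matrix.toBlocks₂₂, Matrix.of_apply,
      liftZ_inr_inl_inr x hP hi, Matrix.zero_apply, if_neg]
    simp only [hcode, Sum.elim_inr]
    have := j.isLt
    omega
  have d22 : D.toBlocks₂₂ = dirichletWindow (x - 1) i c := by
    ext j j'
    rw [hD, Matrix.toBlocks₂₂, Matrix.of_apply, Matrix.toBlocks₂₂, Matrix.of_apply,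
      liftZ_inr_inr_inr x hP hi, dirichletWindow_eq_dz]
    simp [hcode]
  rw [d11, d12, d22, Matrix.det_fromBlocks_zero₁₂, Matrix.det_smul, Matrix.det_one, mul_one,
    Fintype.card_fin]

include hP hi in
/-- **(R3) of THEOREM W.**  If `n + c = 2^k` and `i ≤ n` then
`det d(n + c + i, c)(x) = ± x^c · det d(i, c)(x - 1)`: a window whose rows cross the power of two `2^k` lowers the
Dirichlet parameter by one and contributes the factor `x^c`. -/
theorem det_dirichletWindow_lift : ∃ ε : ℤˣ,
    (dirichletWindow x (n + c + i) c).det = ((ε : ℤ) : R) * (x ^ c * (dirichletWindow (x - 1) i c).det) := by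
  classical
  set τ : Equiv.Perm (Fin n ⊕ (Fin c ⊕ Fin i)) := (liftCols c n i).trans (liftRows c n i).symm with hτ
  refine ⟨Equiv.Perm.sign τ, ?_⟩
  have hB : liftM x c n i =
      ((dirichletWindow x (n + c + i) c).submatrix (liftRows c n i) (liftRows c n i)).submatrix id τ := by
    ext p q
    simp [liftM, hτ, Matrix.submatrix_apply]
  have hdet : (liftM x c n i).det = ((Equiv.Perm.sign τ : ℤ) : R) * (dirichletWindow x (n + c + i) c).det := by
    rw [hB, Matrix.det_permute', Matrix.det_submatrix_equiv_self]
  have hZ : (liftZ x c n i).det = (liftM x c n i).det := by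
    rw [liftZ, Matrix.det_mul, Matrix.det_mul, det_liftL, det_liftP R, one_mul, mul_one]
  have hε : ((Equiv.Perm.sign τ : ℤ) : R) * ((Equiv.Perm.sign τ : ℤ) : R) = 1 := by
    rw [← Int.cast_mul, ← Units.val_mul, Int.units_mul_self, Units.val_one, Int.cast_one]
  calc (dirichletWindow x (n + c + i) c).det
      = (((Equiv.Perm.sign τ : ℤ) : R) * ((Equiv.Perm.sign τ : ℤ) : R)) *
          (dirichletWindow x (n + c + i) c).det := by rw [hε, one_mul]
    _ = ((Equiv.Perm.sign τ : ℤ) : R) * (liftZ x c n i).det := by rw [hZ, hdet, mul_assoc]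
    _ = ((Equiv.Perm.sign τ : ℤ) : R) * (x ^ c * (dirichletWindow (x - 1) i c).det) := by
          rw [det_liftZ x hP hi]

end Matrices

end Lift

end Summit.ValiantsHypothesis.ValiantsHypothesis.Theorems.BarrierLever.MoorePeel
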